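import Summits.NavierStokesRegularity.NavierStokesRegularity.Theorems.ScenarioCensusRowA7hbShear
import Summits.NavierStokesRegularity.NavierStokesRegularity.Theorems.ScenarioCensusRowA7hbVorticity

/-!
# Census row A7hd — census A1 (`LiouvilleConjectureNS`) RESTRICTED to horizontal-valued fields, in A1's own class
# (duality-form bounded ancient mild solutions, jointly continuous) with A1's own conclusion — DECIDED

Re-homed for the scenario census (typer seat ns-census-typer-1 g5; lead MINT INTENT A7hd 15:00Z, queue 15:01Z) = the
port-ready file `landing/ScenarioCensusRowA7hd.lean` (sha16 518bddbab4aa9efb) from ns-idea-2's LINE «horizontal-meter» REV 8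
(pub/ideators/ns-idea-2/lines/horizontal-meter/, line file 32c2c8a1e22262a1), verbatim except: the duplicate `row_A7hb_holds`
dropped (it lives in `ScenarioCensusRowA7hbVorticity`), census key named by the census pattern (`row_A7hd_excluded`);
the second proofs of `Row_A7hb` through A7hd are dropped (the gate dedups restatements; `row_A7hb_of_row_A7hd` stays).  On top of the tree's `ScenarioCensusRowA7hbShear` (`IsBoundedKNSSMild.const_of_ae_const`,
`shearIsConstant`, `row_A7hb_of_B1`) and `ScenarioCensusRowA7hbVorticity` (B1: `B1.repr_curlThird_eq_zero`,
`verticalVorticityVanishesBounded_holds`, `row_A7hb_holds`).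

Contents (namespace `…Theorems.ScenarioCensus.HorizontalMeter`): `Row_A7hd`; bridges `row_A7hd_of_liouvilleConjectureNS`,
`row_A7hd_of_row_A1` (A7hd ⊆ A1 BY NAME); `ae_const_of_shear` (shear-structured horizontal slices of a duality-class
solution are a.e. constant); **`horizontalLiouville`** (pointwise: `u(t,x) = u(t,0)`); **`row_A7hd_holds`**;
`row_A7hb_of_row_A7hd` (A7hd ⟹ A7hb: gauge ⊂ duality class + KNSS Remark 6.1).
Census keys in namespace `…Theorems.ScenarioCensus`: `Row_A7hd`, `row_A7hd_excluded`, `row_A7hd_of_row_A1`, `row_A7hb_of_row_A7hd`.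

No census VALUE is booked here (the lead books); NS regularity is NOT proved; no summit statement is proved by this file.
[cite: KochNadirashviliSereginSverak2009, Thm 5.1, §4, Lemma 2.1, Remark 6.1 (arXiv:0709.3599)]
-/

set_option linter.dupNamespace false

noncomputable section

namespace Summit.NavierStokesRegularity.NavierStokesRegularity.Theorems.ScenarioCensus.HorizontalMeter

open Set Function Filter Topology MeasureTheory
open scoped RealInnerProductSpace InnerProductSpace NNReal Laplacian
open Literature.Analysis Literature.Analysis.FluidPDE
open Summit.NavierStokesRegularity.NavierStokesRegularity

/-! ### REV 8 — the census-language row: A1 (`LiouvilleConjectureNS`) RESTRICTED to horizontal-valued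
fields, in A1's own class (duality-form bounded ancient mild solutions) and with A1's own conclusion -/

/-- `Row_A7hd` — **census A1 restricted to horizontal-valued fields.**  For a bounded ancient mild solution
of Navier–Stokes in the DUALITY class of `LiouvilleConjectureNS` (`IsBoundedAncientMildSolution 1 u`),
jointly continuous on `(−∞, 0) × (EuclideanSpace ℝ (Fin 3))` (which supplies A1's measurability hypothesis) and horizontal-valued
(`u·e₃ ≡ 0`), every slice `u(t, ·)`, `t < 0`, is a.e. equal to a constant — A1's conclusion verbatim.
(The 2D-VALUED companion of the tree's 2.5D Liouville theorem `apply_eq_apply_zero_of_lineInvariant`,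
same hypotheses with «invariant along `e₁`» replaced by «values in the horizontal plane».)  PROVED below
(`row_A7hd_holds`); parent BY NAME `row_A7hd_of_liouvilleConjectureNS`; child `row_A7hb_of_row_A7hd`.
[KNSS2009 Thm 5.1, §4, Lemma 2.1, Remark 6.1 (arXiv:0709.3599)] -/
def Row_A7hd : Prop :=
  ∀ u : ℝ → (EuclideanSpace ℝ (Fin 3)) → (EuclideanSpace ℝ (Fin 3)), IsBoundedAncientMildSolution 1 u → ContinuousOn (uncurry u) (Iio 0 ×ˢ univ) →
    IsHorizontalValued u → ∀ t < 0, ∃ b : (EuclideanSpace ℝ (Fin 3)), u t =ᵐ[volume] fun _ => b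

/-- BRIDGE (kernel-checked): census A1 (`LiouvilleConjectureNS`) gives `Row_A7hd` — A7hd is a sub-cell of A1
BY NAME. -/
theorem row_A7hd_of_liouvilleConjectureNS
    (hL : Summit.NavierStokesRegularity.NavierStokesRegularity.LiouvilleConjectureNS) : Row_A7hd :=
  fun u hu hcont _ t ht =>
    hL u hu (fun _ hs => (continuous_slice_of_continuousOn_Iio hcont hs).aestronglyMeasurable) t ht

/-- BRIDGE: the same from the census decl `ScenarioCensus.Row_A1` (= `LiouvilleConjectureNS`). -/
theorem row_A7hd_of_row_A1 (h : Theorems.ScenarioCensus.Row_A1) : Row_A7hd :=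
  row_A7hd_of_liouvilleConjectureNS h

/-- **Shear-structured horizontal slices of a duality-class bounded ancient mild solution are a.e.
constant** (the body of `shearIsConstant`, REV 6, run in the duality class: the nonlinear integrand
vanishes on continuous bounded horizontal shear slices, so the duality identity is caloric; caloric `L¹`
decay of solenoidal tests and the bounded annihilator lemma).  Continuity of slices replaces the gauge. -/
theorem ae_const_of_shear {u : ℝ → (EuclideanSpace ℝ (Fin 3)) → (EuclideanSpace ℝ (Fin 3))} (hA : IsBoundedAncientMildSolution 1 u)
    (hc : ∀ t < 0, Continuous (u t)) (hh : IsHorizontalValued u)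
    (hshear : ∀ t < 0, ∀ x y : (EuclideanSpace ℝ (Fin 3)), x 2 = y 2 → u t x = u t y) :
    ∀ t < 0, ∃ c : (EuclideanSpace ℝ (Fin 3)), u t =ᵐ[volume] fun _ => c := by
  obtain ⟨B, hB'⟩ := hA.2
  have hB : ∀ t < 0, ∀ x, ‖u t x‖ ≤ B := fun t ht x => hB' t ht x
  have hmeas : ∀ t < 0, AEStronglyMeasurable (u t) volume := fun t ht => (hc t ht).aestronglyMeasurable
  -- the nonlinear integrand vanishes on every slice
  have hN : ∀ τ < 0, ∀ {φ : (EuclideanSpace ℝ (Fin 3)) → (EuclideanSpace ℝ (Fin 3))}, FunctionSpaces.IsTestFunctionOn (⊤ : TopologicalSpace.Opens (EuclideanSpace ℝ (Fin 3))) φ →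
      ∀ σ : ℝ, ∫ x, ⟪u τ x, convect (u τ) (heatTest 1 φ σ) x⟫_ℝ = 0 := fun τ hτ φ hφ σ =>
    integral_inner_convect_heatTest_eq_zero_of_shear (hc τ hτ) (hB τ hτ)
      (hh τ hτ) (hshear τ hτ) hφ 1 σ
  -- hence the identity is caloric between any two times
  have hcal : ∀ {s t : ℝ}, s < t → t < 0 → ∀ {φ : (EuclideanSpace ℝ (Fin 3)) → (EuclideanSpace ℝ (Fin 3))},
      FunctionSpaces.IsTestFunctionOn (⊤ : TopologicalSpace.Opens (EuclideanSpace ℝ (Fin 3))) φ → VectorCalculus.IsDivFree φ →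
      ∫ x, ⟪u t x, φ x⟫_ℝ = ∫ x, ⟪u s x, heatTest 1 φ (t - s) x⟫_ℝ := by
    intro s t hst ht φ hφ hdiv
    have key := hA.1.2 s t hst ht φ hφ hdiv
    simp only [Pi.zero_apply, inner_zero_left, integral_zero, intervalIntegral.integral_zero,
      add_zero] at key
    have hz : ∫ τ in s..t, ∫ x, ⟪u τ x, convect (u τ) (heatTest 1 φ (t - τ)) x⟫_ℝ = 0 := by
      rw [intervalIntegral.integral_congr (g := fun _ => (0 : ℝ)) ?_]
      · simp
      · intro τ hτ
        rw [uIcc_of_le hst.le] at hτ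
        exact hN τ (hτ.2.trans_lt ht) hφ (t - τ)
    rw [hz, add_zero] at key
    exact key
  -- all solenoidal pairings of each slice vanish (caloric `L¹` decay)
  have horth : ∀ t < 0, ∀ φ : (EuclideanSpace ℝ (Fin 3)) → (EuclideanSpace ℝ (Fin 3)), FunctionSpaces.IsTestFunctionOn (⊤ : TopologicalSpace.Opens (EuclideanSpace ℝ (Fin 3))) φ →
      VectorCalculus.IsDivFree φ → ∫ x, ⟪u t x, φ x⟫_ℝ = 0 := by
    intro t ht φ hφ hdiv
    obtain ⟨K, hK0, hK⟩ := exists_integral_norm_heatTest_le_of_isDivFree hφ hdiv one_pos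
    have hB0 : 0 ≤ B := (norm_nonneg _).trans (hB t ht 0)
    have hφi : Integrable φ :=
      hφ.contDiff.continuous.integrable_of_hasCompactSupport hφ.hasCompactSupport
    set a := ∫ x, ⟪u t x, φ x⟫_ℝ with ha
    have hbound : ∀ s' < t, ‖a‖ ≤ B * K * (t - s') ^ (-(1 / 2 : ℝ)) := by
      intro s' hs'
      have hs'0 : s' < 0 := hs'.trans ht
      have hts' : 0 < t - s' := by linarith
      rw [ha, hcal hs' ht hφ hdiv]
      have hψi : Integrable (heatTest 1 φ (t - s')) := integrable_heatFlow hφi _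
      calc ‖∫ x, ⟪u s' x, heatTest 1 φ (t - s') x⟫_ℝ‖
          ≤ ∫ x, B * ‖heatTest 1 φ (t - s') x‖ :=
            norm_integral_le_of_norm_le (hψi.norm.const_mul B) (Eventually.of_forall fun x =>
              (norm_inner_le_norm _ _).trans
                (mul_le_mul_of_nonneg_right (hB s' hs'0 x) (norm_nonneg _)))
        _ = B * ∫ x, ‖heatTest 1 φ (t - s') x‖ := integral_const_mul _ _
        _ ≤ B * (K * (t - s') ^ (-(1 / 2 : ℝ))) := mul_le_mul_of_nonneg_left (hK _ hts') hB0
        _ = B * K * (t - s') ^ (-(1 / 2 : ℝ)) := by ring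
    have htend : Tendsto (fun s' : ℝ => B * K * (t - s') ^ (-(1 / 2 : ℝ))) atBot (𝓝 0) := by
      have h1 : Tendsto (fun s' : ℝ => t - s') atBot atTop := by
        simpa only [sub_eq_add_neg] using
          tendsto_atTop_add_const_left atBot t tendsto_neg_atBot_atTop
      have h2 := (tendsto_rpow_neg_atTop (by norm_num : (0 : ℝ) < 1 / 2)).comp h1
      simpa using h2.const_mul (B * K)
    have hle : ‖a‖ ≤ 0 :=
      ge_of_tendsto htend (by
        filter_upwards [eventually_lt_atBot t] with s' hs' using hbound s' hs')
    exact norm_le_zero_iff.1 hle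
  have hae : ∀ t < 0, ∃ c : (EuclideanSpace ℝ (Fin 3)), u t =ᵐ[volume] fun _ => c := fun t ht =>
    IsWeaklyDivFree.exists_ae_eq_const_of_norm_le_of_forall_integral_inner_eq_zero (hmeas t ht)
      (hB t ht) (hA.1.1 t ht) (horth t ht)
  exact hae

/-- **Horizontal Liouville theorem in the duality class (pointwise form).**  A bounded ancient mild
solution (`IsBoundedAncientMildSolution 1 u`), jointly continuous on `(−∞, 0) × (EuclideanSpace ℝ (Fin 3))`, whose velocity is
everywhere horizontal, is constant in space on every slice: `u(t, x) = u(t, 0)`.  Proof: KNSS §4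
representative `u = U + b(t)` (`KNSS2009_regularity_boundedWeak_ancient_holds`, `repr_sub_eq_sub_of_ae`);
`U₂(t,·)` constant ⇒ `(curl U)₂ ≡ 0` (`B1.repr_curlThird_eq_zero`: Theorem 5.1 one dimension up); the smooth
slices `u(t) = U(t) + c(t)` are divergence free, horizontal, with vanishing vertical vorticity ⇒ constant on
horizontal planes (`planarRigidity_slice`); shear ⇒ a.e. constant (`ae_const_of_shear`); continuity. -/
theorem horizontalLiouville {u : ℝ → (EuclideanSpace ℝ (Fin 3)) → (EuclideanSpace ℝ (Fin 3))} (hu : IsBoundedAncientMildSolution 1 u)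
    (hcont : ContinuousOn (uncurry u) (Iio 0 ×ˢ univ)) (hh : IsHorizontalValued u) :
    ∀ t < 0, ∀ x : (EuclideanSpace ℝ (Fin 3)), u t x = u t 0 := by
  have hslc : ∀ s < 0, Continuous (u s) := fun s hs => continuous_slice_of_continuousOn_Iio hcont hs
  -- `u` is a bounded weak solution; its §4 representative
  have hmeas : AEStronglyMeasurable (uncurry u)
      ((volume : Measure (ℝ × (EuclideanSpace ℝ (Fin 3)))).restrict (Iio 0 ×ˢ univ)) :=
    hcont.aestronglyMeasurable (measurableSet_Iio.prod MeasurableSet.univ)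
  have hsl : ∀ s < 0, AEStronglyMeasurable (u s) volume := fun s hs => (hslc s hs).aestronglyMeasurable
  have hw : IsBoundedWeakNSSolutionOn (Iio 0) isOpen_Iio 1 u :=
    hu.isBoundedWeakNSSolutionOn one_pos hmeas hsl
  obtain ⟨U, b, hbm, hbC, hUm, hae, hsmooth, hdivU, hbd, hlip, hvort⟩ :=
    KNSS2009_regularity_boundedWeak_ancient_holds hw
  have hsub := repr_sub_eq_sub_of_ae hcont hae hsmooth hlip
  -- the third component of the representative is constant in space at every time
  have h3 : ∀ s < 0, ∀ x : (EuclideanSpace ℝ (Fin 3)), U s x 2 = U s 0 2 := by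
    intro s hs x
    have h := congr_arg (fun v : (EuclideanSpace ℝ (Fin 3)) => v 2) (hsub s hs x 0)
    simp only [PiLp.sub_apply] at h
    rw [hh s hs x, hh s hs 0, sub_self] at h
    linarith
  have hU0 := B1.repr_curlThird_eq_zero hbm hbC hUm hsmooth hbd hlip hvort h3
  -- the slices `u(t) = U(t) + c(t)`: smooth, divergence free, vanishing vertical vorticity
  have hfun : ∀ s < 0, u s = fun z => U s z + (u s 0 - U s 0) := by
    intro s hs
    funext z
    have h := hsub s hs z 0
    rw [sub_eq_sub_iff_add_eq_add] at h
    rw [add_sub, eq_sub_iff_add_eq]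
    exact h.symm
  have hsm : ∀ s < 0, ContDiff ℝ 2 (u s) := fun s hs => by
    rw [hfun s hs]
    exact ((hsmooth s hs).of_le (by norm_cast)).add contDiff_const
  have hdiv : ∀ s < 0, VectorCalculus.IsDivFree (u s) := fun s hs => by
    intro x
    have h := hdivU s hs x
    rw [hfun s hs]
    simp only [VectorCalculus.divergence, fderiv_add_const] at h ⊢
    exact h
  have hcurl : ∀ s < 0, ∀ y, curl (u s) y 2 = 0 := fun s hs y => by
    have e : curl (u s) y = curl (U s) y := by
      rw [hfun s hs]
      simp only [curl, fderiv_add_const]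
    rw [e]
    exact hU0 s hs y
  obtain ⟨B, hB'⟩ := hu.2
  -- planar rigidity slice by slice: `u(t)` is a horizontal shear field
  have hshear : ∀ s < 0, ∀ x y : (EuclideanSpace ℝ (Fin 3)), x 2 = y 2 → u s x = u s y := fun s hs x y hxy =>
    planarRigidity_slice (hsm s hs) (fun z => hB' s hs z) (hdiv s hs) (fun z => hh s hs z)
      (fun z => hcurl s hs z) x y hxy
  -- shear ⇒ a.e. constant ⇒ constant, by continuity
  have hae2 := ae_const_of_shear hu hslc hh hshear
  intro t ht x
  obtain ⟨c, hc⟩ := hae2 t ht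
  have e : u t = fun _ => c := (Continuous.ae_eq_iff_eq volume (hslc t ht) continuous_const).1 hc
  rw [congrFun e x, congrFun e 0]

/-- **`Row_A7hd` KERNEL-CLOSED (REV 8 of the line)** — census A1 restricted to horizontal-valued (jointly continuous)
fields holds.  No summit proved. -/
theorem row_A7hd_holds : Row_A7hd := fun u hu hcont hh t ht =>
  ⟨u t 0, Eventually.of_forall fun x => horizontalLiouville hu hcont hh t ht x⟩

/-- BRIDGE (kernel-checked): `Row_A7hd → Row_A7hb` — the gauge class is a jointly continuous subclass of the
duality class (`IsBoundedKNSSMild.isBoundedAncientMildSolution`), and a.e.-constant slices in the gauge are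
ONE constant (`IsBoundedKNSSMild.const_of_ae_const`, KNSS Remark 6.1).  So the chain of cells reads
A1 ⟹ A7hd ⟹ A7hb ⟹ A7h, all decided except A1. -/
theorem row_A7hb_of_row_A7hd (h : Row_A7hd) : Row_A7hb := fun u hu hh =>
  hu.const_of_ae_const (h u hu.isBoundedAncientMildSolution hu.1.continuousOn hh)

end Summit.NavierStokesRegularity.NavierStokesRegularity.Theorems.ScenarioCensus.HorizontalMeter

namespace Summit.NavierStokesRegularity.NavierStokesRegularity.Theorems.ScenarioCensus

/-- Census row A7hd — (any type · no symmetry · bounded ancient mild in A1's OWN duality class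
`IsBoundedAncientMildSolution 1 u`, jointly continuous on `(−∞,0) × ℝ³`, horizontal-valued `u·e₃ ≡ 0`): every slice is
a.e. constant (A1's conclusion verbatim), BY NAME `HorizontalMeter.Row_A7hd` (ns-idea-2 LINE «horizontal-meter» REV 8,
VERBATIM).  Closed by `row_A7hd_excluded`; the census lead books the value. -/
def Row_A7hd : Prop := HorizontalMeter.Row_A7hd

/-- A7hd is PROVED in the tree: `HorizontalMeter.row_A7hd_holds`.  No summit proved. -/
theorem row_A7hd_excluded : Row_A7hd := HorizontalMeter.row_A7hd_holds

/-- Lattice: A1 ⇒ A7hd BY NAME. -/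
theorem row_A7hd_of_row_A1 (h : Row_A1) : Row_A7hd := HorizontalMeter.row_A7hd_of_row_A1 h

/-- Lattice: A7hd ⇒ A7hb (gauge ⊂ duality class; KNSS Remark 6.1). -/
theorem row_A7hb_of_row_A7hd (h : Row_A7hd) : Row_A7hb := HorizontalMeter.row_A7hb_of_row_A7hd h

end Summit.NavierStokesRegularity.NavierStokesRegularity.Theorems.ScenarioCensus
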